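import Mathlib
import Summits.AtomisticToContinuum.Crystallization.Theses.EnergyDerivativeOrder
import Literature.MathematicalPhysics.StatisticalMechanics.HcpHomogeneous
import Summits.AtomisticToContinuum.Crystallization.Theorems.EnergyDerivativeOrderLimitTransferHcpShells

/-!
# Birth skeleton — piece P3 `SpectrumSelectsHcp` of the split of C2 `SpectralRigidityHcp`
# (route EnergyDerivativeOrder, stmt-AtomisticToContinuum-12278; crux-strategist 2026-08-17)

Line: COORDINATES / ARITHMETIC / SYMMETRY.  A cubic-type layer triple `s k = s (k-1)` of a Barlow
stacking realises the squared distances `a²/3 + 4h²` (sites `(k+1,i,j-… )`: `(P,Q) = (0,∓1)`,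
`Λ = ±2`, `K = 2` in `twelve_mul_dist_sq`) and `16a²/3 + 4h²` (`(P,Q) = (∓2,±2)`)
[`stub_cubicTriple_witness`]; in the window the first is a squared hcp distance only at the ideal
ratio `h² = ⅔a²`, and then the second (`= 8a²`) is not (`8`, `66` not Löschian)
[`stub_witness_not_in_hcp_spectrum`]; so the spectral hypothesis forces `s (k+1) = -s k` for all
`k`, i.e. `s = ±alternatingHagg`, and both signs code `hcpStacking a h` up to the half-turn
`(x,y,z) ↦ (-x,-y,z)` of `HcpHomogeneous.lean` [`stub_signFlip_congruent`].  `SpectrumSelectsHcp_of`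
is the kernel-checked composition (the contradiction loop lives in it, not in a stub).
The piece is restated here verbatim (`def SpectrumSelectsHcp`) until the route split installs the
decl `EnergyDerivativeOrder.SpectrumSelectsHcp`; re-point the conclusion then.
-/

noncomputable section

namespace Summit.AtomisticToContinuum.Crystallization.Cruxes.SpectralRigidityHcp.SpectrumSelectsHcpBirth

open Literature.MathematicalPhysics.StatisticalMechanics

/-- Piece P3 of the C2 split (verbatim; becomes `EnergyDerivativeOrder.SpectrumSelectsHcp`). -/
def SpectrumSelectsHcp : Prop :=
  ∀ a h : ℝ, 0 < a → |h / a - Real.sqrt (2 / 3)| ≤ 1 / 400 → ∀ s : ℤ → ℤ, IsHaggSeq s → (∀ p ∈ barlowStacking a h s, ∀ q ∈ barlowStacking a h s, p ≠ q → ∃ p' ∈ hcpStacking a h, ∃ q' ∈ hcpStacking a h, dist p q = dist p' q') → ∃ g : EuclideanSpace ℝ (Fin 3) ≃ᵢ EuclideanSpace ℝ (Fin 3), barlowStacking a h s = g '' hcpStacking a h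

/-- STUB A (coordinates, S): a cubic-type layer triple `s k = s (k - 1)` (layers `k-1, k, k+1`
pairwise in different letters) realises, between layers `k - 1` and `k + 1`, the squared
distances `a²/3 + 4h²` and `16a²/3 + 4h²` (`twelve_mul_dist_sq` with `K = 2`, `Λ = ±2`). -/
theorem stub_cubicTriple_witness :
    ∀ (a h : ℝ) (s : ℤ → ℤ), IsHaggSeq s → ∀ k : ℤ, s k = s (k - 1) → (∃ p ∈ barlowStacking a h s, ∃ q ∈ barlowStacking a h s, dist p q ^ 2 = a ^ 2 / 3 + 4 * h ^ 2) ∧ (∃ p ∈ barlowStacking a h s, ∃ q ∈ barlowStacking a h s, dist p q ^ 2 = 16 * a ^ 2 / 3 + 4 * h ^ 2) := by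
  sorry

/-- STUB B (arithmetic of the relaxed hcp spectrum in the window, M): `a²/3 + 4h²` is a squared
hcp distance only at the ideal ratio (`1/3 + 4r ∈ spec² ⇔ r = 2/3`: `K = 0` forces the Löschian
value `3`, `K = ±1` forces `m = 3r = 2`), and at the ideal ratio `16a²/3 + 4h² = 8a²` is not
(`8 = 2³` and `66 = 2·3·11` are not Löschian). -/
theorem stub_witness_not_in_hcp_spectrum :
    ∀ a h : ℝ, 0 < a → |h / a - Real.sqrt (2 / 3)| ≤ 1 / 400 → (∀ p ∈ hcpStacking a h, ∀ q ∈ hcpStacking a h, dist p q ^ 2 = a ^ 2 / 3 + 4 * h ^ 2 → h ^ 2 = 2 / 3 * a ^ 2) ∧ (h ^ 2 = 2 / 3 * a ^ 2 → ∀ p ∈ hcpStacking a h, ∀ q ∈ hcpStacking a h, dist p q ^ 2 ≠ 16 * a ^ 2 / 3 + 4 * h ^ 2) := by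
  sorry

/-- STUB C (symmetry bookkeeping, S/M): a sign-alternating Hägg sequence is `±alternatingHagg`;
`barlowStacking a h alternatingHagg = hcpStacking a h` and
`barlowStacking a h (-alternatingHagg) = halfTurn '' hcpStacking a h` (`HcpHomogeneous.halfTurn`
negates the letter offset `w` and fixes `u, v`-lattice and `e₃`). -/
theorem stub_signFlip_congruent :
    ∀ (a h : ℝ) (s : ℤ → ℤ), IsHaggSeq s → (∀ k : ℤ, s (k + 1) = -s k) → ∃ g : EuclideanSpace ℝ (Fin 3) ≃ᵢ EuclideanSpace ℝ (Fin 3), barlowStacking a h s = g '' hcpStacking a h := by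
  sorry

/-- **Composition** `A → B → C → SpectrumSelectsHcp`: if some `s (k+1) = s k`, stub A gives two
witness pairs of the stacking; by the spectral hypothesis their distances are hcp distances, so
stub B forces the ideal ratio from the first and refutes the second — contradiction; hence `s` is
sign-alternating and stub C concludes. -/
theorem SpectrumSelectsHcp_of
    (hA : ∀ (a h : ℝ) (s : ℤ → ℤ), IsHaggSeq s → ∀ k : ℤ, s k = s (k - 1) → (∃ p ∈ barlowStacking a h s, ∃ q ∈ barlowStacking a h s, dist p q ^ 2 = a ^ 2 / 3 + 4 * h ^ 2) ∧ (∃ p ∈ barlowStacking a h s, ∃ q ∈ barlowStacking a h s, dist p q ^ 2 = 16 * a ^ 2 / 3 + 4 * h ^ 2))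
    (hB : ∀ a h : ℝ, 0 < a → |h / a - Real.sqrt (2 / 3)| ≤ 1 / 400 → (∀ p ∈ hcpStacking a h, ∀ q ∈ hcpStacking a h, dist p q ^ 2 = a ^ 2 / 3 + 4 * h ^ 2 → h ^ 2 = 2 / 3 * a ^ 2) ∧ (h ^ 2 = 2 / 3 * a ^ 2 → ∀ p ∈ hcpStacking a h, ∀ q ∈ hcpStacking a h, dist p q ^ 2 ≠ 16 * a ^ 2 / 3 + 4 * h ^ 2))
    (hC : ∀ (a h : ℝ) (s : ℤ → ℤ), IsHaggSeq s → (∀ k : ℤ, s (k + 1) = -s k) → ∃ g : EuclideanSpace ℝ (Fin 3) ≃ᵢ EuclideanSpace ℝ (Fin 3), barlowStacking a h s = g '' hcpStacking a h) :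
    SpectrumSelectsHcp := by
  intro a h ha hwin s hs hD
  obtain ⟨hB1, hB2⟩ := hB a h ha hwin
  have key : ∀ k : ℤ, s (k + 1) ≠ s k := by
    intro k hk
    have hk' : s (k + 1) = s (k + 1 - 1) := by rw [add_sub_cancel_right]; exact hk
    obtain ⟨⟨p, hp, q, hq, hpq⟩, ⟨p', hp', q', hq', hpq'⟩⟩ := hA a h s hs (k + 1) hk'
    have hne : p ≠ q := by
      rintro rfl
      rw [dist_self] at hpq
      nlinarith [sq_nonneg h]
    have hne' : p' ≠ q' := by
      rintro rfl
      rw [dist_self] at hpq'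
      nlinarith [sq_nonneg h]
    obtain ⟨p₁, hp₁, q₁, hq₁, hd⟩ := hD p hp q hq hne
    have hideal : h ^ 2 = 2 / 3 * a ^ 2 := hB1 p₁ hp₁ q₁ hq₁ (by rw [← hd]; exact hpq)
    obtain ⟨p₂, hp₂, q₂, hq₂, hd'⟩ := hD p' hp' q' hq' hne'
    exact hB2 hideal p₂ hp₂ q₂ hq₂ (by rw [← hd']; exact hpq')
  refine hC a h s hs (fun k => ?_)
  rcases hs (k + 1) with h1 | h1 <;> rcases hs k with h2 | h2
  · exact absurd (h1.trans h2.symm) (key k)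
  · rw [h1, h2]; norm_num
  · rw [h1, h2]
  · exact absurd (h1.trans h2.symm) (key k)

end Summit.AtomisticToContinuum.Crystallization.Cruxes.SpectralRigidityHcp.SpectrumSelectsHcpBirth

end
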